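import Summits.BirchSwinnertonDyer.BirchSwinnertonDyer.Theorems.ByReductionTypeAtTwoRankOneAtTwoOffBigImageOddLocalDefs
import HarnessLib

/-!
# Route `ByReductionTypeAtTwo`, crux `RankOneAtTwoOffBigImageOddLocal` (stmt-BirchSwinnertonDyer-23716), line
# `refined_kolyvagin_tamagawa_shift_at_two`: the IMAGE CELLS and the `σ ≥ 1` K3 statement of the re-lined skeleton (g11)

Lead prover `prover-cruxlead-stmt-BirchSwinnertonDyer-23716-g4` (2026-08-28).  Companion to `…OffBigImageOddLocalDefs.lean` (p643983; at the
400-line cap, hence a second statement module rather than an append).  The pen's ruling RC-308 (bsd-2adic-plan GEN 28, 2026-08-28T19:17Z) on the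
g3 lead's hand-back of the K3 stub S5′ `ShiftedKolyvaginStructureModTwoAtTwo` («contains route `GenusKolyvaginAtTwo`'s open crux 22137») is a
RE-LINE INSIDE THE SKELETON: the by-name stub absorbs the sibling route's K-side items — 22137 `KolyvaginExactAtTwo` (the `σ = 0` slice on the
full-image cell, bridge p660076) and 27469 `KolyvaginExactAtTwoShifted` (EVERY `σ` on {full image, `Δ < 0`}, bridge
`…OffBigImageOddLocalShiftedSiblingBridge.lean`) — and what is nobody's item is cut into two cells: {full `2`-adic image, `Δ > 0`} at `σ ≥ 1`
(the regime of the line's regular-Frobenius engine, `…Engine*.lean`) and the γ₂ cell (`ρ̄_{W,2}` onto, `ρ_{W,2^∞}` not onto).  This module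
states, as closed importable declarations over the first module's vocabulary:

* the IMAGE CELLS `OnFullImageCell` / `OffFullImageCell` (moved here VERBATIM from the skeleton g10, §3⁶, where the g3 lead introduced them) and
  `OnDeltaMinusFullCell` (`Δ < 0` ∧ full image — the habitat of 27469; the `Δ > 0` twin is the first module's `OnDeltaPlusCell`);
* `ShiftedKolyvaginStructureModTwoWithOnPos Φ Ω` — the cell statement S5″(Φ, Ω) of the first module with ONE extra binder `0 < σ(W, Dt)`
  (character-identical otherwise), so that its `Ω := OnDeltaPlusCell` instance does not restate 22137's `Δ > 0` child 24883
  `KolyvaginExactAtTwoPosDisc` (the `σ = 0` slice), which the skeleton consumes by name.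

Statements only (the line's stub signatures and cell vocabulary — to be proved / refuted / reshaped; nothing is asserted; locators in plain
text so that no stub signature is relocated to `Literature/`).  BSD is not proved by any of this; the crux is not proved; the `σ ≥ 1` statement
on `Δ > 0` is open mathematics at `p = 2` (McCallum 1991 §5 is `p` odd; on `Δ > 0` complex conjugation fixes `E[2]` pointwise, so `E[2^M]` is not
`ℤ[c₀]`-cyclic and the equivariant mechanism of the sibling's `Δ < 0` programme has no carrier — the line's answer is a Kolyvagin prime whose
Frobenius is a REGULAR involution, `Engine.exists_regular_kolyvaginPrime_of_heegner`).

References (locators): McCallum, LMS LNS 153 (1991) §5, Thm. 5.4; W. Zhang, Camb. J. Math. 2 (2014) Notations (xii); Jetchev 2008 (1.3);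
Burungale–Castella–Grossi–Skinner, arXiv:2312.09301 Thm. 2; Dokchitser–Dokchitser, Math. Z. (2012); Rouse–Zureick-Brown (2015).
-/

set_option linter.dupNamespace false -- tree convention: `Summit.BirchSwinnertonDyer.BirchSwinnertonDyer.Theorems` (summit = sub-problem)
set_option autoImplicit false

noncomputable section

open scoped Classical

namespace Summit.BirchSwinnertonDyer.BirchSwinnertonDyer.Theorems.OffBigImageOddLocalAtTwo

open WeierstrassCurve NumberField Literature.NumberTheory.EllipticCurves
  Literature.NumberTheory.EllipticCurves.ModularForms

/-- **Cell δ (plain-typed): the full `2`-adic image**, `ρ_{W,2^n}` onto for every `n` (instance binder inside, as in `OnDeltaPlusCell`, so the cell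
has type `WeierstrassCurve ℚ → Prop`).  The habitat of route `GenusKolyvaginAtTwo`'s K-side cruxes 22137 / 27469 / 24883.  Moved verbatim from the
skeleton (g10, §3⁶). (RouseZureickbrown2015, §1) -/
def OnFullImageCell (W : WeierstrassCurve ℚ) : Prop :=
  ∀ [W.IsElliptic] (n : ℕ), W.HasSurjectiveModNGaloisRep ((2 ^ n : ℕ) : ℤ)

/-- **Cell γ₂ (plain-typed): NOT the full `2`-adic image** — on the mod-`2`-surjective locus these are the four RZB / Dokchitser–Dokchitser families
γ₂a/b/c/d (`InRZBListAtTwo` minus its first disjunct; `inRZBList_iff_not_surjective`).  Moved verbatim from the skeleton (g10, §3⁶).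
(DokchitserDokchitserMathZ2012, Theorem (2)–(3)) -/
def OffFullImageCell (W : WeierstrassCurve ℚ) : Prop :=
  ¬ OnFullImageCell W

/-- **Cell δ⁻, plain-typed: `Δ < 0` and full `2`-adic image** — the habitat of the sibling route's σ-shifted structure theorem 27469
`KolyvaginExactAtTwoShifted` (complex conjugation is a transposition on `E[2]`, `E[2^M]` is `ℤ/2^M[c₀]`-free of rank one).  The `Δ > 0` twin is
`OnDeltaPlusCell`. (McCallumLMS1991, §5) -/
def OnDeltaMinusFullCell (W : WeierstrassCurve ℚ) : Prop :=
  W.Δ < 0 ∧ ∀ [W.IsElliptic] (n : ℕ), W.HasSurjectiveModNGaloisRep ((2 ^ n : ℕ) : ℤ)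

/-- **S5⁺(Φ, Ω) `ShiftedKolyvaginStructureModTwoWithOnPos Φ Ω` — K3 with witness filter `Φ` on the cell `Ω`, POSITIVE SHIFT ONLY:**
`ShiftedKolyvaginStructureModTwoWithOn Φ Ω` (first module) with the single extra binder `0 < σ(W, Dt)` after the infinite-order hypothesis on
`y_K = P(1)`; every other character identical.  For `W` globally minimal non-CM with `ρ̄_{W,2}` onto in the cell `Ω`, a Kolyvagin-admissible `K`,
any datum with `σ(W, Dt) = v₂ ∏ c_ℓ(W) + v₂ c(Dt) ≥ 1`, `2^{M₀} ∥ P(1)`: K1-shape (every `P(n)` is `2^{min(σ, M(n))}`-divisible) ∧ K2(Φ)-shape (some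
`P(n)` at level `M(n) ≥ σ + 1` on `Φ`-primes is not `2^{σ+1}`-divisible) ⟹ `#Ш(E/K)[2^∞] = 2^{2(M₀ − σ)}`.  The `σ = 0` slice is deliberately
excluded: on the full-image cell it is route `GenusKolyvaginAtTwo`'s crux 22137 (either sign of `Δ`), consumed by name.  The registered instance
of the re-lined skeleton is `Φ = ⊤`, `Ω = OnDeltaPlusCell` (full image, `Δ > 0`): McCallum's Thm. 5.4 «`N_i = M_{i−1} − M_i`, `#Ш[p^∞] =
p^{2(M₀ − M_∞)}`» read at `p = 2` with `M_∞ = σ ≥ 1` where `c₀` fixes `E[2]` — OPEN (nothing in print at `2`). (McCallumLMS1991, §5 Thm. 5.4) -/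
def ShiftedKolyvaginStructureModTwoWithOnPos (Φ : WeierstrassCurve ℚ → ℕ → Prop) (Ω : WeierstrassCurve ℚ → Prop) : Prop :=
  ∀ (W : WeierstrassCurve ℚ) [W.IsElliptic] [W.IsGloballyMinimal] [NeZero (W.conductorNorm ℤ)],
    ¬ W.HasCM → W.HasSurjectiveModNGaloisRep 2 → Ω W →
    ∀ (K : Type) [Field K] [NumberField K], IsImaginaryQuadratic K → Odd (NumberField.discr K) →
      NumberField.discr K ≠ -3 → SatisfiesHeegnerHypothesis (W.conductorNorm ℤ) K →
      ¬ IsSquare ((NumberField.discr K : ℚ) * -|W.Δ|) → ¬ IsSquare ((NumberField.discr K : ℚ) * (-(2 * |W.Δ|))) →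
      ∀ (Dt : ModularParametrizationData W (W.conductorNorm ℤ)) (β : ℤ) (ι : K →+* ℂ) (d₁ : KolyvaginHeegnerData Dt β ι 1),
        ¬ IsOfFinAddOrder d₁.derivedPoint → 0 < sigmaShift W Dt →
        ∀ (M₀ : ℕ), (∃ Q : (W.baseChange (ringClassField K ι 1)).toAffine.Point, ((2 ^ M₀ : ℕ) : ℤ) • Q = d₁.derivedPoint) →
          (¬ ∃ Q : (W.baseChange (ringClassField K ι 1)).toAffine.Point, ((2 ^ (M₀ + 1) : ℕ) : ℤ) • Q = d₁.derivedPoint) →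
          (∀ (n : ℕ) (d : KolyvaginHeegnerData Dt β ι n) (m : ℕ), Squarefree n →
              (∀ ℓ ∈ n.primeFactors, Zhang2014.IsKolyvaginPrime (W.conductorNorm ℤ) W K 2 ℓ) →
              (m : ℕ∞) ≤ Zhang2014.levelIndex W 2 n → m ≤ sigmaShift W Dt →
              ∃ Q : (W.baseChange (ringClassField K ι n)).toAffine.Point, ((2 ^ m : ℕ) : ℤ) • Q = d.derivedPoint) →
          ∀ (n : ℕ) (d : KolyvaginHeegnerData Dt β ι n), Squarefree n →
            (∀ ℓ ∈ n.primeFactors, Zhang2014.IsKolyvaginPrime (W.conductorNorm ℤ) W K 2 ℓ ∧ Φ W ℓ) →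
            ((sigmaShift W Dt + 1 : ℕ) : ℕ∞) ≤ Zhang2014.levelIndex W 2 n →
            (¬ ∃ Q : (W.baseChange (ringClassField K ι n)).toAffine.Point,
              ((2 ^ (sigmaShift W Dt + 1) : ℕ) : ℤ) • Q = d.derivedPoint) →
            Nat.card (AddCommGroup.primaryComponent (W.baseChange K).sha 2) = 2 ^ (2 * (M₀ - sigmaShift W Dt))

end Summit.BirchSwinnertonDyer.BirchSwinnertonDyer.Theorems.OffBigImageOddLocalAtTwo

end
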